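import Summits.Ventures.PercRepro.S1CFGDepFourSharpBase

/-!
# PercRepro — THE SHARP TRIANGLE CAP: `c₃ ≤ C(ν + 1, 3)` FOR EVERY SIMPLE COLOOP-FREE MATROID OF NULLITY `ν ≥ 2`
ON `n ≥ ν + 5` POINTS (p1, gen 41)

The landed cap (S1CFGTrianglesAll, `ncard_three_eRk_le_two_le_choose_succ_add_one_of_add_three_le`) is
`c₃ ≤ C(ν + 1, 3) + 1` on `n ≥ ν + 3` points, and the `+1` is attained only in rank `3` (a `(ν + 1)`-point line and
a triangle through one of its points) and rank `4` (the line and a disjoint triangle, `U_{2,ν+1} ⊕ U_{2,3}`). This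
module proves that from rank `5` on (`n ≥ ν + 5`) the `+1` disappears: **`c₃ ≤ C(ν + 1, 3)`**, attained by
`U_{2,ν+1} ⊕ U_{3,4}` (the line and a disjoint `4`-circuit) — so the cap is exact for every `n ≥ ν + 5`.

Proof (induction on `ν` from `2`, all `n` at once, the series-pair dichotomy of §4ab).
* BASE `ν = 2`, `n ≥ 7`: two distinct rank-`2` triples cover the ground set (`union_eq_ground_of_two_triangles`),
  impossible on `≥ 7` points, so `c₃ ≤ 1 = C(3, 3)` (`ncard_three_eRk_le_two_le_one_of_nullity_two`).
* STEP `ν ≥ 3`, `n ≥ ν + 5`, a SERIES PAIR `e, f` (`f ∉ cl (E ∖ {e, f})`): with `Z` the series class of `e` and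
  `S = E ∖ Z` (coloop-free, simple, nullity `ν − 1`, `rk S + |Z| = rk E + 1`; S1CFGSeriesClass), every rank-`2`
  triple lies in `S` or passes through `e` (a circuit meeting `Z` contains `Z`):
  `c₃ ≤ c₃(S) + #{triples ∋ e}` (`ncard_three_eRk_le_two_le_sdiff_seriesClass_add`). If `|Z| ≤ 3` then `rk S ≥ 3`
  and the landed `+1` cap on `M ↾ S` gives `c₃(S) ≤ C(ν, 3) + 1`, at most one triple passes through `e`, and
  `C(ν, 3) + 2 ≤ C(ν + 1, 3)` as `C(ν, 2) ≥ 3`; if `|Z| ≥ 4` no triple passes through `e` (it would contain `Z`;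
  `ncard_three_eRk_le_two_mem_eq_zero_of_four_le`) and the crude cap on `S` gives `c₃(S) ≤ C(ν + 1, 3)`.
* STEP, NO SERIES PAIR: every `M ↾ (E ∖ {e})` is simple, coloop-free, of nullity `ν − 1` on `n − 1 ≥ (ν − 1) + 5`
  points (`ncard_three_eRk_le_two_sdiff_le_of_cap_five`), the induction hypothesis gives `c₃(E ∖ e) ≤ C(ν, 3)`, the
  averaging double count `(n − 3)·c₃ ≤ n·C(ν, 3)` (landed `mul_ncard_three_eRk_le_two_le`), and the arithmetic
  `le_choose_succ_of_mul_le` (`3·C(ν + 1, 3) = (ν + 1)·C(ν, 2)`, `n − 3 ≥ ν + 2`) forces `c₃ ≤ C(ν + 1, 3)`.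
**`ncard_three_eRk_le_two_le_choose_succ_sharp`** is the cap (`ν ≥ 2`, `n ≥ ν + 5`); numerals
`triangles_sharp_{three,four,five,six,seven}` = `4 / 10 / 20 / 35 / 56` at `ν = 3 / 4 / 5 / 6 / 7` on
`n ≥ 8 / 9 / 10 / 11 / 12`. Nothing about any cell is claimed. Axioms: standard.
-/

open scoped Matroid

namespace PercRepro

namespace S1CFG

open Set S1CF

variable {α : Type}

/-- A `3`-set of rank `≤ 2` of a matroid with no dependent pair is a circuit. -/
theorem isCircuit_of_three_eRk_le_two (M : Matroid α) [M.Finite]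
    (h0 : {P : Set α | P ⊆ M.E ∧ P.ncard = 2 ∧ M.Dep P}.ncard = 0) {X : Set α} (hXE : X ⊆ M.E)
    (hX3 : X.ncard = 3) (hXr : M.eRk X ≤ 2) : M.IsCircuit X := by
  have hXfin : X.Finite := M.ground_finite.subset hXE
  have hXdep : M.Dep X := by
    rw [← Matroid.eRk_lt_encard_iff_dep_of_finite hXfin hXE, ← hXfin.cast_ncard_eq, hX3]
    exact lt_of_le_of_lt hXr (by norm_num)
  exact isCircuit_of_dep_three_of_no_dep_pair M hXE hX3 hXdep
    (fun P hPX hP2 hPdep => hPdep.not_indep (indep_of_ncard_eq_two_of_no_dep_pair M h0 (hPX.trans hXE) hP2))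

/-- **THE BASE `ν = 2`**: a simple coloop-free matroid of nullity `2` on `n ≥ 7` points has at most one rank-`2`
triple (two of them would cover the ground set). -/
theorem ncard_three_eRk_le_two_le_one_of_nullity_two (M : Matroid α) [M.Finite]
    (hd : M.E.encard = M.eRank + ((2 : ℕ) : ℕ∞)) (hK : ∀ e, ¬ M.IsColoop e)
    (h0 : {P : Set α | P ⊆ M.E ∧ P.ncard = 2 ∧ M.Dep P}.ncard = 0) (hn : 7 ≤ M.E.ncard) :
    {X : Set α | X ⊆ M.E ∧ X.ncard = 3 ∧ M.eRk X ≤ 2}.ncard ≤ 1 := by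
  have hEfin := M.ground_finite
  rw [Set.ncard_le_one_iff (hEfin.finite_subsets.subset (fun X hX => hX.1))]
  intro T₁ T₂ hT₁ hT₂
  by_contra hne
  have hU := union_eq_ground_of_two_triangles M hd hK h0 hT₁ hT₂ hne
  have h1 : (T₁ ∪ T₂).ncard ≤ T₁.ncard + T₂.ncard := Set.ncard_union_le _ _
  rw [hU, hT₁.2.1, hT₂.2.1] at h1
  omega

/-- **THE SPLIT AT A SERIES CLASS**: every rank-`2` triple lies in `E ∖ Z(e)` or passes through `e` (a circuit
meeting the series class `Z(e)` contains it). -/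
theorem ncard_three_eRk_le_two_le_sdiff_seriesClass_add (M : Matroid α) [M.Finite] (hK : ∀ e, ¬ M.IsColoop e)
    (h0 : {P : Set α | P ⊆ M.E ∧ P.ncard = 2 ∧ M.Dep P}.ncard = 0) {e : α} (he : e ∈ M.E) :
    {X : Set α | X ⊆ M.E ∧ X.ncard = 3 ∧ M.eRk X ≤ 2}.ncard ≤
      {X : Set α | X ⊆ M.E \ {z | z ∈ M.E ∧ (z = e ∨ z ∉ M.closure (M.E \ {e, z}))} ∧ X.ncard = 3 ∧
        M.eRk X ≤ 2}.ncard +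
      {X : Set α | X ⊆ M.E ∧ X.ncard = 3 ∧ M.eRk X ≤ 2 ∧ e ∈ X}.ncard := by
  classical
  have hEfin := M.ground_finite
  have hAfin : {X : Set α | X ⊆ M.E \ {z | z ∈ M.E ∧ (z = e ∨ z ∉ M.closure (M.E \ {e, z}))} ∧ X.ncard = 3 ∧
      M.eRk X ≤ 2}.Finite :=
    hEfin.finite_subsets.subset (fun X hX => hX.1.trans sdiff_subset)
  have hBfin : {X : Set α | X ⊆ M.E ∧ X.ncard = 3 ∧ M.eRk X ≤ 2 ∧ e ∈ X}.Finite :=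
    hEfin.finite_subsets.subset (fun X hX => hX.1)
  refine (Set.ncard_le_ncard ?_ (hAfin.union hBfin)).trans (Set.ncard_union_le _ _)
  intro X hX
  obtain ⟨hXE, hX3, hXr⟩ := hX
  by_cases hXS : X ⊆ M.E \ {z | z ∈ M.E ∧ (z = e ∨ z ∉ M.closure (M.E \ {e, z}))}
  · exact Or.inl ⟨hXS, hX3, hXr⟩
  · right
    refine ⟨hXE, hX3, hXr, ?_⟩
    obtain ⟨z, hzX, hzS⟩ : ∃ z ∈ X, z ∉ M.E \ {z | z ∈ M.E ∧ (z = e ∨ z ∉ M.closure (M.E \ {e, z}))} := by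
      by_contra h
      push Not at h
      exact hXS h
    have hzZ : z ∈ {z | z ∈ M.E ∧ (z = e ∨ z ∉ M.closure (M.E \ {e, z}))} := by
      by_contra hzZ
      exact hzS ⟨hXE hzX, hzZ⟩
    have hC : M.IsCircuit X := isCircuit_of_three_eRk_le_two M h0 hXE hX3 hXr
    exact isCircuit_seriesClass_subset M hK he hC hzZ hzX (mem_seriesClass_self M he)

/-- **No rank-`2` triple through `e` when its series class has `≥ 4` points** (such a triple is a circuit
through `e`, hence contains the class). -/
theorem ncard_three_eRk_le_two_mem_eq_zero_of_four_le (M : Matroid α) [M.Finite] (hK : ∀ e, ¬ M.IsColoop e)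
    (h0 : {P : Set α | P ⊆ M.E ∧ P.ncard = 2 ∧ M.Dep P}.ncard = 0) {e : α} (he : e ∈ M.E)
    (hZ : 4 ≤ {z | z ∈ M.E ∧ (z = e ∨ z ∉ M.closure (M.E \ {e, z}))}.ncard) :
    {X : Set α | X ⊆ M.E ∧ X.ncard = 3 ∧ M.eRk X ≤ 2 ∧ e ∈ X}.ncard = 0 := by
  have hEfin := M.ground_finite
  rw [Set.ncard_eq_zero (hEfin.finite_subsets.subset (fun X hX => hX.1)), Set.eq_empty_iff_forall_notMem]
  rintro X ⟨hXE, hX3, hXr, heX⟩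
  have hC : M.IsCircuit X := isCircuit_of_three_eRk_le_two M h0 hXE hX3 hXr
  have hZX := isCircuit_seriesClass_subset_of_mem M hK he hC heX
  have := Set.ncard_le_ncard hZX (hEfin.subset hXE)
  omega

/-- The arithmetic of the averaging step without the slack: `(n − 3)·c ≤ n·C(ν, 3)` with `n ≥ ν + 5`, `ν ≥ 2`
forces `c ≤ C(ν + 1, 3)` (`3·C(ν + 1, 3) = (ν + 1)·C(ν, 2)`, `C(ν, 2) ≥ 1`). -/
theorem le_choose_succ_of_mul_le {n ν c : ℕ} (hν : 2 ≤ ν) (hn : ν + 5 ≤ n)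
    (h : (n - 3) * c ≤ n * ν.choose 3) : c ≤ (ν + 1).choose 3 := by
  by_contra hc
  push Not at hc
  have hP : (ν + 1).choose 3 = ν.choose 2 + ν.choose 3 := Nat.choose_succ_succ' ν 2
  have h3 : (ν + 1) * ν.choose 2 = (ν + 1).choose 3 * 3 := Nat.add_one_mul_choose_eq ν 2
  have hq : 1 ≤ ν.choose 2 := by
    have := Nat.choose_le_choose 2 hν
    simpa using this
  obtain ⟨m, rfl⟩ : ∃ m, n = m + 3 := ⟨n - 3, by omega⟩
  rw [Nat.add_sub_cancel] at h
  have hm : ν + 2 ≤ m := by omega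
  have h1 : m * ((ν + 1).choose 3 + 1) ≤ (m + 3) * ν.choose 3 :=
    (Nat.mul_le_mul_left m hc).trans h
  have h2 : (ν + 2) * ν.choose 2 ≤ m * ν.choose 2 := Nat.mul_le_mul_right _ hm
  rw [hP] at h1 h3
  nlinarith [h1, h2, h3, hq, hm, hν]

/-- **THE RESTRICTION TO `E ∖ {e}` UNDER «NO SERIES PAIR AT `e`», with `n ≥ ν + 5`**: `M ↾ (E ∖ {e})` is simple,
coloop-free, of nullity `ν − 1` on `n − 1 ≥ (ν − 1) + 5` points, and any cap valid for such matroids bounds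
`c₃(E ∖ e)`. -/
theorem ncard_three_eRk_le_two_sdiff_le_of_cap_five (M : Matroid α) [M.Finite] {ν : ℕ}
    (hd : M.E.encard = M.eRank + (ν : ℕ∞)) (hK : ∀ e, ¬ M.IsColoop e)
    (h0 : {P : Set α | P ⊆ M.E ∧ P.ncard = 2 ∧ M.Dep P}.ncard = 0) {e : α} (he : e ∈ M.E)
    (hser : ∀ f ∈ M.E, f ≠ e → f ∈ M.closure (M.E \ {e, f})) {B : ℕ}
    (hcap : ∀ (N : Matroid α) [N.Finite], N.E.encard = N.eRank + ((ν - 1 : ℕ) : ℕ∞) →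
      (∀ x, ¬ N.IsColoop x) → {P : Set α | P ⊆ N.E ∧ P.ncard = 2 ∧ N.Dep P}.ncard = 0 →
      ν - 1 + 5 ≤ N.E.ncard → {X : Set α | X ⊆ N.E ∧ X.ncard = 3 ∧ N.eRk X ≤ 2}.ncard ≤ B)
    (hn : ν + 5 ≤ M.E.ncard) (hν : 1 ≤ ν) :
    {X : Set α | X ⊆ M.E \ {e} ∧ X.ncard = 3 ∧ M.eRk X ≤ 2}.ncard ≤ B := by
  have hSE : M.E \ {e} ⊆ M.E := sdiff_subset
  haveI : (M ↾ (M.E \ {e})).Finite := M.restrict_finite (M.ground_finite.subset hSE)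
  have hrk : M.eRk (M.E \ {e}) = M.eRk M.E := eRk_sdiff_singleton_eq_of_not_isColoop M he (hK e)
  have hnE := ncard_ground_eq_eRk_toNat_add M hd
  have hcard : (M.E \ {e}).ncard = M.E.ncard - 1 := Set.ncard_sdiff_singleton_of_mem he
  have hScard : (M.E \ {e}).ncard = (M.eRk (M.E \ {e})).toNat + (ν - 1) := by
    rw [hcard, hrk]
    omega
  have hK' : ∀ x, ¬ (M ↾ (M.E \ {e})).IsColoop x := by
    refine restrict_hK M hSE ?_
    intro x hx
    have hxe : x ≠ e := fun h => hx.2 (by rw [h]; exact mem_singleton e)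
    rw [sdiff_singleton_sdiff_singleton_eq]
    exact hser x hx.1 hxe
  have hn' : ν - 1 + 5 ≤ (M ↾ (M.E \ {e})).E.ncard := by
    rw [Matroid.restrict_ground_eq]
    omega
  have hres := hcap (M ↾ (M.E \ {e})) (restrict_hd M hSE hScard) hK' (restrict_h0 M hSE h0) hn'
  rw [restrict_count_three] at hres
  exact hres

/-- **THE INDUCTION STEP**: the sharp cap at nullity `ν ≥ 3` on `n ≥ ν + 5` points from the sharp cap
`c₃ ≤ C(ν, 3)` for simple coloop-free matroids of nullity `ν − 1` on `≥ (ν − 1) + 5` points. -/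
theorem ncard_three_eRk_le_two_le_choose_succ_of_cap (M : Matroid α) [M.Finite] {ν : ℕ}
    (hd : M.E.encard = M.eRank + (ν : ℕ∞)) (hK : ∀ e, ¬ M.IsColoop e)
    (h0 : {P : Set α | P ⊆ M.E ∧ P.ncard = 2 ∧ M.Dep P}.ncard = 0) (hν : 3 ≤ ν) (hn : ν + 5 ≤ M.E.ncard)
    (hcap : ∀ (N : Matroid α) [N.Finite], N.E.encard = N.eRank + ((ν - 1 : ℕ) : ℕ∞) →
      (∀ x, ¬ N.IsColoop x) → {P : Set α | P ⊆ N.E ∧ P.ncard = 2 ∧ N.Dep P}.ncard = 0 →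
      ν - 1 + 5 ≤ N.E.ncard →
      {X : Set α | X ⊆ N.E ∧ X.ncard = 3 ∧ N.eRk X ≤ 2}.ncard ≤ ν.choose 3) :
    {X : Set α | X ⊆ M.E ∧ X.ncard = 3 ∧ M.eRk X ≤ 2}.ncard ≤ (ν + 1).choose 3 := by
  have hP : (ν + 1).choose 3 = ν.choose 2 + ν.choose 3 := Nat.choose_succ_succ' ν 2
  have hq : 3 ≤ ν.choose 2 := by
    have := Nat.choose_le_choose 2 hν
    simpa using this
  have hnE := ncard_ground_eq_eRk_toNat_add M hd
  by_cases hser : ∃ e ∈ M.E, ∃ f ∈ M.E, e ≠ f ∧ f ∉ M.closure (M.E \ {e, f})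
  · -- a series pair: split at the series class `Z` of `e`
    obtain ⟨e, he, f, hf, hef, h⟩ := hser
    set Z := {z | z ∈ M.E ∧ (z = e ∨ z ∉ M.closure (M.E \ {e, z}))} with hZ
    have hSE : M.E \ Z ⊆ M.E := sdiff_subset
    haveI : (M ↾ (M.E \ Z)).Finite := M.restrict_finite (M.ground_finite.subset hSE)
    have hsplit : {X : Set α | X ⊆ M.E ∧ X.ncard = 3 ∧ M.eRk X ≤ 2}.ncard ≤
        {X : Set α | X ⊆ M.E \ Z ∧ X.ncard = 3 ∧ M.eRk X ≤ 2}.ncard +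
        {X : Set α | X ⊆ M.E ∧ X.ncard = 3 ∧ M.eRk X ≤ 2 ∧ e ∈ X}.ncard :=
      ncard_three_eRk_le_two_le_sdiff_seriesClass_add M hK h0 he
    have hrkZ : (M.eRk (M.E \ Z)).toNat + Z.ncard = (M.eRk M.E).toNat + 1 :=
      eRk_toNat_sdiff_seriesClass_add M hK he
    have hScard : (M.E \ Z).ncard = (M.eRk (M.E \ Z)).toNat + (ν - 1) :=
      ncard_sdiff_seriesClass_eq M hd hK he (by omega)
    have hmem1 : {X : Set α | X ⊆ M.E ∧ X.ncard = 3 ∧ M.eRk X ≤ 2 ∧ e ∈ X}.ncard ≤ 1 :=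
      ncard_three_eRk_le_two_mem_le_one M hK h0 he hf hef h
    by_cases hZ3 : Z.ncard ≤ 3
    · -- `rk S ≥ 3`: the landed `+1` cap on `M ↾ S`
      have hn' : ν - 1 + 3 ≤ (M ↾ (M.E \ Z)).E.ncard := by
        rw [Matroid.restrict_ground_eq]
        omega
      have hcapS := triangle_cap_of_two_le (M ↾ (M.E \ Z)) (by omega : 2 ≤ ν - 1) (restrict_hd M hSE hScard)
        (restrict_hK M hSE (fun x hx => mem_closure_sdiff_seriesClass M hK he hx)) (restrict_h0 M hSE h0) hn'
      rw [restrict_count_three, Nat.sub_add_cancel (by omega : 1 ≤ ν)] at hcapS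
      omega
    · -- `|Z| ≥ 4`: no triple through `e`; the crude cap on `S`
      have hmem0 : {X : Set α | X ⊆ M.E ∧ X.ncard = 3 ∧ M.eRk X ≤ 2 ∧ e ∈ X}.ncard = 0 :=
        ncard_three_eRk_le_two_mem_eq_zero_of_four_le M hK h0 he (by show 4 ≤ Z.ncard; omega)
      have hcrude : {X : Set α | X ⊆ M.E \ Z ∧ X.ncard = 3 ∧ M.eRk X ≤ 2}.ncard ≤
          ((M.E \ Z).ncard - (M.eRk (M.E \ Z)).toNat + 2).choose 3 :=
        ncard_three_eRk_le_two_le_of_no_dep_pair_restrict M h0 hSE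
      have heq : (M.E \ Z).ncard - (M.eRk (M.E \ Z)).toNat + 2 = ν + 1 := by omega
      rw [heq] at hcrude
      omega
  · -- no series pair: every `M ↾ (E ∖ e)` is coloop-free; average
    push Not at hser
    have hB : ∀ e ∈ M.E, {X : Set α | X ⊆ M.E \ {e} ∧ X.ncard = 3 ∧ M.eRk X ≤ 2}.ncard ≤ ν.choose 3 :=
      fun e he => ncard_three_eRk_le_two_sdiff_le_of_cap_five M hd hK h0 he
        (fun f hf hfe => hser e he f hf (Ne.symm hfe)) hcap hn (by omega)
    exact le_choose_succ_of_mul_le (by omega) hn (mul_ncard_three_eRk_le_two_le M hB)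

/-- **THE SHARP TRIANGLE CAP FOR EVERY `n ≥ ν + 5`**: a simple (no dependent pair), coloop-free matroid of
nullity `ν ≥ 2` on `n ≥ ν + 5` points has at most `C(ν + 1, 3)` triangles (`3`-sets of rank `≤ 2`). -/
theorem ncard_three_eRk_le_two_le_choose_succ_of_add_five_le :
    ∀ ν : ℕ, 2 ≤ ν → ∀ (M : Matroid α) [M.Finite], M.E.encard = M.eRank + (ν : ℕ∞) →
      (∀ e, ¬ M.IsColoop e) → {P : Set α | P ⊆ M.E ∧ P.ncard = 2 ∧ M.Dep P}.ncard = 0 →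
      ν + 5 ≤ M.E.ncard →
      {X : Set α | X ⊆ M.E ∧ X.ncard = 3 ∧ M.eRk X ≤ 2}.ncard ≤ (ν + 1).choose 3 := by
  intro ν hν
  induction ν, hν using Nat.le_induction with
  | base =>
    intro M _ hd hK h0 hn
    have h1 : (2 + 1).choose 3 = 1 := by decide
    rw [h1]
    exact ncard_three_eRk_le_two_le_one_of_nullity_two M hd hK h0 (by omega)
  | succ ν hν ih =>
    intro M _ hd hK h0 hn
    refine ncard_three_eRk_le_two_le_choose_succ_of_cap M hd hK h0 (by omega) hn ?_
    intro N _ hd' hK' h0' hn'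
    rw [Nat.add_sub_cancel] at hd' hn'
    exact ih N hd' hK' h0' hn'

/-- The sharp cap in the usual hypothesis form: `ν ≥ 2`, `n ≥ ν + 5`, `c₃ ≤ C(ν + 1, 3)`. -/
theorem ncard_three_eRk_le_two_le_choose_succ_sharp (M : Matroid α) [M.Finite] {ν : ℕ}
    (hd : M.E.encard = M.eRank + (ν : ℕ∞)) (hK : ∀ e, ¬ M.IsColoop e)
    (h0 : {P : Set α | P ⊆ M.E ∧ P.ncard = 2 ∧ M.Dep P}.ncard = 0) (hν : 2 ≤ ν) (hn : ν + 5 ≤ M.E.ncard) :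
    {X : Set α | X ⊆ M.E ∧ X.ncard = 3 ∧ M.eRk X ≤ 2}.ncard ≤ (ν + 1).choose 3 :=
  ncard_three_eRk_le_two_le_choose_succ_of_add_five_le ν hν M hd hK h0 hn

/-- `c₃ ≤ 4` at nullity `3` on `n ≥ 8` points. -/
theorem triangles_sharp_three (M : Matroid α) [M.Finite]
    (hd : M.E.encard = M.eRank + 3) (hK : ∀ e, ¬ M.IsColoop e)
    (h0 : {P : Set α | P ⊆ M.E ∧ P.ncard = 2 ∧ M.Dep P}.ncard = 0) (hn : 8 ≤ M.E.ncard) :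
    {X : Set α | X ⊆ M.E ∧ X.ncard = 3 ∧ M.eRk X ≤ 2}.ncard ≤ 4 := by
  have := ncard_three_eRk_le_two_le_choose_succ_sharp M (ν := 3) (by exact_mod_cast hd) hK h0
    (by norm_num) (by omega)
  exact this.trans (by decide)

/-- `c₃ ≤ 10` at nullity `4` on `n ≥ 9` points. -/
theorem triangles_sharp_four (M : Matroid α) [M.Finite]
    (hd : M.E.encard = M.eRank + 4) (hK : ∀ e, ¬ M.IsColoop e)
    (h0 : {P : Set α | P ⊆ M.E ∧ P.ncard = 2 ∧ M.Dep P}.ncard = 0) (hn : 9 ≤ M.E.ncard) :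
    {X : Set α | X ⊆ M.E ∧ X.ncard = 3 ∧ M.eRk X ≤ 2}.ncard ≤ 10 := by
  have := ncard_three_eRk_le_two_le_choose_succ_sharp M (ν := 4) (by exact_mod_cast hd) hK h0
    (by norm_num) (by omega)
  exact this.trans (by decide)

/-- `c₃ ≤ 20` at nullity `5` on `n ≥ 10` points. -/
theorem triangles_sharp_five (M : Matroid α) [M.Finite]
    (hd : M.E.encard = M.eRank + 5) (hK : ∀ e, ¬ M.IsColoop e)
    (h0 : {P : Set α | P ⊆ M.E ∧ P.ncard = 2 ∧ M.Dep P}.ncard = 0) (hn : 10 ≤ M.E.ncard) :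
    {X : Set α | X ⊆ M.E ∧ X.ncard = 3 ∧ M.eRk X ≤ 2}.ncard ≤ 20 := by
  have := ncard_three_eRk_le_two_le_choose_succ_sharp M (ν := 5) (by exact_mod_cast hd) hK h0
    (by norm_num) (by omega)
  exact this.trans (by decide)

/-- `c₃ ≤ 35` at nullity `6` on `n ≥ 11` points. -/
theorem triangles_sharp_six (M : Matroid α) [M.Finite]
    (hd : M.E.encard = M.eRank + 6) (hK : ∀ e, ¬ M.IsColoop e)
    (h0 : {P : Set α | P ⊆ M.E ∧ P.ncard = 2 ∧ M.Dep P}.ncard = 0) (hn : 11 ≤ M.E.ncard) :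
    {X : Set α | X ⊆ M.E ∧ X.ncard = 3 ∧ M.eRk X ≤ 2}.ncard ≤ 35 := by
  have := ncard_three_eRk_le_two_le_choose_succ_sharp M (ν := 6) (by exact_mod_cast hd) hK h0
    (by norm_num) (by omega)
  exact this.trans (by decide)

/-- `c₃ ≤ 56` at nullity `7` on `n ≥ 12` points. -/
theorem triangles_sharp_seven (M : Matroid α) [M.Finite]
    (hd : M.E.encard = M.eRank + 7) (hK : ∀ e, ¬ M.IsColoop e)
    (h0 : {P : Set α | P ⊆ M.E ∧ P.ncard = 2 ∧ M.Dep P}.ncard = 0) (hn : 12 ≤ M.E.ncard) :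
    {X : Set α | X ⊆ M.E ∧ X.ncard = 3 ∧ M.eRk X ≤ 2}.ncard ≤ 56 := by
  have := ncard_three_eRk_le_two_le_choose_succ_sharp M (ν := 7) (by exact_mod_cast hd) hK h0
    (by norm_num) (by omega)
  exact this.trans (by decide)

end S1CFG

end PercRepro
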